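import Literature.Analysis.FluidPDE.ElgindiEllipticVeryWeak
import HarnessLib

/-!
# The energy solution tested against the profiles `cos²θ·χ`: the very weak equation up to the
# angular boundary ([Elgindi2021] §7.1, Proposition 7.1)

Topic `Literature/Analysis/FluidPDE`. Proof file (everything proved, no definitions, no named
facts) on the proof path of the named fact
`Literature.Analysis.FluidPDE.Elgindi.ElgindiGhoulMasmoudi2021_stabilityCore`
(`ElgindiStabilityDecomposition.lean`). T. M. Elgindi, Ann. of Math. 194 (2021) =
arXiv:1904.04795, §7.1 Proposition 7.1 (p. 19 of the held text).

`ElgindiEllipticVeryWeak.lean` derived `∫∫ U₀·ᵗL(Φ) = ∫∫ F·Φ` for test functions `Φ` compactly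
supported in the OPEN strip. Here the same identity is proved for the profiles `Φ = cos²θ·χ(R,θ)`,
`χ` smooth and compactly supported inside `R > 0` with `χ(R,0) = 0` — test functions up to the
angular boundary, for which `ᵗL(Φ)` stays bounded (`integral_energySol_transposeOp_cosSq`). This is
the very weak formulation in which square-integrable solutions are unique
(`ElgindiClassVeryWeakUniqueness.lean`), so it identifies the Lax–Milgram solution with every other
finite-energy construction (weighted spaces, dilates). Ingredients: the graph relations of the
energy space with test functions up to the boundary — radial (`weakSpace_inner_one'`), angular by
parts on `[0, π/2]` using `Ψ(R,0) = Ψ(R,π/2) = 0` of the graphs (`weakSpace_inner_two'`), and the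
pointwise `tan` relation for `φ = cos θ·ψ` (`weakSpace_inner_three'`).
-/

noncomputable section

open MeasureTheory Set Real Filter Function
open _root_.Topology
open scoped ENNReal InnerProductSpace

namespace Literature.Analysis.FluidPDE

namespace Elgindi

section test

variable {φ : ℝ → ℝ → ℝ}

/-- **Graph relation 1 on graphs, test functions up to the angular boundary**:
`∫∫ (αR cos θ∂_Rχ)φ = −α∫∫ cos θχ(φ + R∂_Rφ)` for `φ ∈ C¹_c` supported inside `R > 0`. [folklore] -/
theorem integral_graphFn_one_mul' (hφ : ContDiff ℝ 1 (uncurry φ)) (hφs : HasCompactSupport (uncurry φ))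
    (hφP : ∀ p ∈ tsupport (uncurry φ), 0 < p.1) {α : ℝ} {χ : ℝ → ℝ → ℝ} (hχ : ContDiff ℝ 1 (uncurry χ)) :
    ∫ p in strip, graphFn α χ 1 p * φ p.1 p.2 = -α * ∫ p in strip, graphFn α χ 0 p * (φ p.1 p.2 + p.1 * dz φ p.1 p.2) := by
  have cχ : Continuous fun p : ℝ × ℝ => χ p.1 p.2 := hχ.continuous
  have cdzχ : Continuous fun p : ℝ × ℝ => dz χ p.1 p.2 := (contDiff_dz_of_contDiff (n := 0) hχ).continuous
  have cφ : Continuous fun p : ℝ × ℝ => φ p.1 p.2 := hφ.continuous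
  have cdzφ : Continuous fun p : ℝ × ℝ => dz φ p.1 p.2 := (contDiff_dz_of_contDiff (n := 0) hφ).continuous
  have sφ : HasCompactSupport fun p : ℝ × ℝ => φ p.1 p.2 := hφs
  have sdzφ : HasCompactSupport fun p : ℝ × ℝ => dz φ p.1 p.2 := hasCompactSupport_dz hφs
  have iL : Integrable fun p : ℝ × ℝ => graphFn α χ 1 p * φ p.1 p.2 := ((continuous_graphFn hχ 1).mul cφ).integrable_of_hasCompactSupport sφ.mul_left
  have iR : Integrable fun p : ℝ × ℝ => graphFn α χ 0 p * (φ p.1 p.2 + p.1 * dz φ p.1 p.2) :=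
    ((continuous_graphFn hχ 0).mul (by fun_prop)).integrable_of_hasCompactSupport ((sφ.add (sdzφ.mul_left (f := fun p : ℝ × ℝ => p.1))).mul_left)
  rw [integral_strip_eq_integral_Ioo_integral_Ioi iL, integral_strip_eq_integral_Ioo_integral_Ioi iR, ← MeasureTheory.integral_const_mul]
  refine setIntegral_congr_fun measurableSet_Ioo fun θ hθ => ?_
  -- slice in `R`: `u = χ(·,θ)`, `v = φ(·,θ)`; `H = u·R·v`, `H' = u'Rv + u(v + Rv')`
  have hu : ContDiff ℝ 1 fun R => χ R θ := hχ.comp (contDiff_id.prodMk contDiff_const)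
  have hv : ContDiff ℝ 1 fun R => φ R θ := hφ.comp (contDiff_id.prodMk contDiff_const)
  have hdu : Differentiable ℝ fun R => χ R θ := hu.differentiable (by simp)
  have hdv : Differentiable ℝ fun R => φ R θ := hv.differentiable (by simp)
  have hvs : HasCompactSupport fun R => φ R θ :=
    HasCompactSupport.of_support_subset_isCompact (hφs.image continuous_fst) fun R hR => ⟨(R, θ), subset_tsupport _ hR, rfl⟩
  have hv's : HasCompactSupport fun R => dz φ R θ := hvs.deriv
  have e1 : ∀ R, deriv (fun R => χ R θ) R = dz χ R θ := fun R => rfl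
  have e2 : ∀ R, deriv (fun R => φ R θ) R = dz φ R θ := fun R => rfl
  have hH : ∀ R, HasDerivAt (fun R => χ R θ * (R * φ R θ)) (dz χ R θ * (R * φ R θ) + χ R θ * (φ R θ + R * dz φ R θ)) R := by
    intro R
    have h1 : HasDerivAt (fun R => R * φ R θ) (1 * φ R θ + R * dz φ R θ) R := (hasDerivAt_id R).mul (hdv R).hasDerivAt
    have := (hdu R).hasDerivAt.mul h1
    rw [e1] at this
    refine this.congr_deriv ?_; ring
  have cH' : Continuous fun R => dz χ R θ * (R * φ R θ) + χ R θ * (φ R θ + R * dz φ R θ) := by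
    have := cdzχ.comp (Continuous.prodMk_right θ); have := cχ.comp (Continuous.prodMk_right θ)
    have := cφ.comp (Continuous.prodMk_right θ); have := cdzφ.comp (Continuous.prodMk_right θ)
    fun_prop
  have sH : HasCompactSupport fun R => χ R θ * (R * φ R θ) := (hvs.mul_left (f := fun R => R)).mul_left
  have sH' : HasCompactSupport fun R => dz χ R θ * (R * φ R θ) + χ R θ * (φ R θ + R * dz φ R θ) :=
    ((hvs.mul_left (f := fun R => R)).mul_left).add ((hvs.add (hv's.mul_left (f := fun R => R))).mul_left)
  have key : ∫ R, (dz χ R θ * (R * φ R θ) + χ R θ * (φ R θ + R * dz φ R θ)) = 0 := by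
    have h0 : Tendsto (fun R => χ R θ * (R * φ R θ)) (cocompact ℝ) (𝓝 0) := sH.is_zero_at_infty
    have := integral_of_hasDerivAt_of_tendsto hH (cH'.integrable_of_hasCompactSupport sH') (h0.mono_left atBot_le_cocompact)
      (h0.mono_left atTop_le_cocompact)
    rw [sub_zero] at this; exact this
  have i1 : Integrable fun R => dz χ R θ * (R * φ R θ) := by
    have := cdzχ.comp (Continuous.prodMk_right θ); have := cφ.comp (Continuous.prodMk_right θ)
    exact (by fun_prop : Continuous fun R => dz χ R θ * (R * φ R θ)).integrable_of_hasCompactSupport ((hvs.mul_left (f := fun R => R)).mul_left)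
  have i2 : Integrable fun R => χ R θ * (φ R θ + R * dz φ R θ) := by
    have := cχ.comp (Continuous.prodMk_right θ); have := cφ.comp (Continuous.prodMk_right θ); have := cdzφ.comp (Continuous.prodMk_right θ)
    exact (by fun_prop : Continuous fun R => χ R θ * (φ R θ + R * dz φ R θ)).integrable_of_hasCompactSupport
      ((hvs.add (hv's.mul_left (f := fun R => R))).mul_left)
  rw [integral_add i1 i2] at key
  -- pass from `ℝ` to `(0,∞)`: the integrands vanish for `R ≤ 0` (support of `φ` in the strip)
  have hφ0 : ∀ R ≤ (0:ℝ), φ R θ = 0 := fun R hR => by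
    have hn : ((R, θ) : ℝ × ℝ) ∉ tsupport (uncurry φ) := fun h => absurd (hφP _ h) (not_lt.2 hR)
    have := image_eq_zero_of_notMem_tsupport hn
    exact this
  have hdzφ0 : ∀ R < (0:ℝ), dz φ R θ = 0 := fun R hR => by
    show deriv (fun R' => φ R' θ) R = 0
    have h0 : (fun R' => φ R' θ) =ᶠ[𝓝 R] fun _ => 0 := Filter.eventuallyEq_of_mem (Iio_mem_nhds hR) fun x hx => hφ0 x hx.le
    rw [h0.deriv_eq, deriv_const]
  have toIoi : ∀ {g : ℝ → ℝ}, (∀ R < 0, g R = 0) → g 0 = 0 → ∫ R, g R = ∫ R in Ioi 0, g R := fun {g} hg hg0 => by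
    rw [← setIntegral_eq_integral_of_forall_compl_eq_zero (s := Ioi (0:ℝ)) fun R hR => ?_]
    simp only [Set.mem_Ioi, not_lt] at hR
    rcases hR.lt_or_eq with h | h
    · exact hg R h
    · rw [h]; exact hg0
  rw [toIoi (fun R hR => by simp [hφ0 R hR.le]) (by simp [hφ0 0 le_rfl]),
    toIoi (fun R hR => by simp [hφ0 R hR.le, hdzφ0 R hR]) (by simp [hφ0 0 le_rfl])] at key
  -- identify with the graph components
  have eL : ∫ R in Ioi (0:ℝ), graphFn α χ 1 (R, θ) * φ (R, θ).1 (R, θ).2 = α * Real.cos θ * ∫ R in Ioi (0:ℝ), dz χ R θ * (R * φ R θ) := by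
    rw [← MeasureTheory.integral_const_mul]
    refine setIntegral_congr_fun measurableSet_Ioi fun R _ => ?_
    show α * (R * (Real.cos θ * dz χ R θ)) * φ R θ = α * Real.cos θ * (dz χ R θ * (R * φ R θ))
    ring
  have eR : ∫ R in Ioi (0:ℝ), graphFn α χ 0 (R, θ) * (φ (R, θ).1 (R, θ).2 + (R, θ).1 * dz φ (R, θ).1 (R, θ).2) =
      Real.cos θ * ∫ R in Ioi (0:ℝ), χ R θ * (φ R θ + R * dz φ R θ) := by
    rw [← MeasureTheory.integral_const_mul]
    refine setIntegral_congr_fun measurableSet_Ioi fun R _ => ?_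
    show Real.cos θ * χ R θ * (φ R θ + R * dz φ R θ) = Real.cos θ * (χ R θ * (φ R θ + R * dz φ R θ))
    ring
  rw [eL, eR]
  have : (∫ R in Ioi (0:ℝ), dz χ R θ * (R * φ R θ)) = -∫ R in Ioi (0:ℝ), χ R θ * (φ R θ + R * dz φ R θ) := by linarith
  rw [this]; ring

/-- **Graph relation 2 on graphs, up to the angular boundary**: for a graph profile
`Ψ = cos θχ` of the class (`χ(R,0) = 0`, so `Ψ(R,0) = Ψ(R,π/2) = 0`) and any `φ ∈ C¹_c` supported
inside `R > 0`, `∫∫_strip ∂_θΨ·φ = −∫∫_strip Ψ∂_θφ`. [folklore] -/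
theorem integral_graphFn_two_mul' (hφ : ContDiff ℝ 1 (uncurry φ))
    {α : ℝ} {χ : ℝ → ℝ → ℝ} (hχ : ContDiff ℝ 1 (uncurry χ)) (hχs : HasCompactSupport (uncurry χ)) (hχ0 : ∀ R, χ R 0 = 0) :
    ∫ p in strip, graphFn α χ 2 p * φ p.1 p.2 = -∫ p in strip, graphFn α χ 0 p * dθ φ p.1 p.2 := by
  obtain ⟨Ψ, hΨ⟩ : ∃ Ψ : ℝ → ℝ → ℝ, Ψ = fun R θ => Real.cos θ * χ R θ := ⟨_, rfl⟩
  have hΨ1 : ContDiff ℝ 1 (uncurry Ψ) := by rw [hΨ]; exact contDiff_cosProfile hχ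
  have hΨs : HasCompactSupport (uncurry Ψ) := by rw [hΨ]; exact hasCompactSupport_cosProfile hχs
  have cΨ : Continuous fun p : ℝ × ℝ => Ψ p.1 p.2 := hΨ1.continuous
  have cdθΨ : Continuous fun p : ℝ × ℝ => dθ Ψ p.1 p.2 := (contDiff_dθ_of_contDiff (n := 0) hΨ1).continuous
  have cφ : Continuous fun p : ℝ × ℝ => φ p.1 p.2 := hφ.continuous
  have cdθφ : Continuous fun p : ℝ × ℝ => dθ φ p.1 p.2 := (contDiff_dθ_of_contDiff (n := 0) hφ).continuous
  have sΨ : HasCompactSupport fun p : ℝ × ℝ => Ψ p.1 p.2 := hΨs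
  have sdθΨ : HasCompactSupport fun p : ℝ × ℝ => dθ Ψ p.1 p.2 := hasCompactSupport_dθ_of hΨs
  have g2 : ∀ p : ℝ × ℝ, graphFn α χ 2 p = dθ Ψ p.1 p.2 := fun p => by rw [hΨ, dθ_cosProfile hχ]; rfl
  have g0 : ∀ p : ℝ × ℝ, graphFn α χ 0 p = Ψ p.1 p.2 := fun p => by rw [hΨ]; rfl
  simp only [g2, g0]
  have iL : Integrable fun p : ℝ × ℝ => dθ Ψ p.1 p.2 * φ p.1 p.2 := (cdθΨ.mul cφ).integrable_of_hasCompactSupport sdθΨ.mul_right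
  have iR : Integrable fun p : ℝ × ℝ => Ψ p.1 p.2 * dθ φ p.1 p.2 := (cΨ.mul cdθφ).integrable_of_hasCompactSupport sΨ.mul_right
  rw [integral_strip_eq_integral_Ioi_integral_Ioo iL, integral_strip_eq_integral_Ioi_integral_Ioo iR, ← MeasureTheory.integral_neg]
  refine setIntegral_congr_fun measurableSet_Ioi fun R _ => ?_
  have hb : (0:ℝ) ≤ π / 2 := by positivity
  have hu : ContDiff ℝ 1 fun θ => Ψ R θ := hΨ1.comp (contDiff_const.prodMk contDiff_id)
  have hv : ContDiff ℝ 1 fun θ => φ R θ := hφ.comp (contDiff_const.prodMk contDiff_id)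
  have hdu : Differentiable ℝ fun θ => Ψ R θ := hu.differentiable (by simp)
  have hdv : Differentiable ℝ fun θ => φ R θ := hv.differentiable (by simp)
  have hD0 : Ψ R 0 = 0 := by rw [hΨ]; simp [hχ0 R]
  have hD1 : Ψ R (π / 2) = 0 := by rw [hΨ]; simp
  have key := intervalIntegral.integral_deriv_mul_eq_sub (a := 0) (b := π / 2) (u := fun θ => Ψ R θ) (v := fun θ => φ R θ)
    (u' := fun θ => dθ Ψ R θ) (v' := fun θ => dθ φ R θ) (fun θ _ => (hdu θ).hasDerivAt) (fun θ _ => (hdv θ).hasDerivAt)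
    ((by have := cdθΨ.comp (Continuous.prodMk_right R); exact this : Continuous fun θ => dθ Ψ R θ).intervalIntegrable _ _)
    ((by have := cdθφ.comp (Continuous.prodMk_right R); exact this : Continuous fun θ => dθ φ R θ).intervalIntegrable _ _)
  simp only [hD0, hD1, zero_mul, sub_zero] at key
  have i1 : IntervalIntegrable (fun θ => dθ Ψ R θ * φ R θ) volume 0 (π / 2) :=
    ((by have := cdθΨ.comp (Continuous.prodMk_right R); exact this : Continuous fun θ => dθ Ψ R θ).mul
      (by have := cφ.comp (Continuous.prodMk_right R); exact this)).intervalIntegrable _ _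
  have i2 : IntervalIntegrable (fun θ => Ψ R θ * dθ φ R θ) volume 0 (π / 2) :=
    ((by have := cΨ.comp (Continuous.prodMk_right R); exact this : Continuous fun θ => Ψ R θ).mul
      (by have := cdθφ.comp (Continuous.prodMk_right R); exact this)).intervalIntegrable _ _
  rw [intervalIntegral.integral_add i1 i2] at key
  rw [← integral_Ioc_eq_integral_Ioo, ← intervalIntegral.integral_of_le hb, ← integral_Ioc_eq_integral_Ioo,
    ← intervalIntegral.integral_of_le hb]
  simp only []
  linarith

/-- **Graph relation 3 on graphs, for `φ = cos θ·ψ`**: `∫∫ (sin θχ)(cos θψ) = ∫∫ (cos θχ)(sin θψ)`. [folklore] -/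
theorem integral_graphFn_three_mul' {α : ℝ} (χ ψ : ℝ → ℝ → ℝ) :
    ∫ p in strip, graphFn α χ 3 p * (Real.cos p.2 * ψ p.1 p.2) = ∫ p in strip, graphFn α χ 0 p * (Real.sin p.2 * ψ p.1 p.2) := by
  refine integral_congr_ae (ae_of_all _ fun p => ?_)
  show Real.sin p.2 * χ p.1 p.2 * (Real.cos p.2 * ψ p.1 p.2) = Real.cos p.2 * χ p.1 p.2 * (Real.sin p.2 * ψ p.1 p.2)
  ring

/-! ### The relations on the energy space -/

/-- **`⟨U₁, φ⟩ = −α⟨U₀, φ + R∂_Rφ⟩`** for `φ ∈ C¹_c` supported inside `R > 0`. [folklore] -/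
theorem weakSpace_inner_one' (hφ : ContDiff ℝ 1 (uncurry φ)) (hφs : HasCompactSupport (uncurry φ))
    (hφP : ∀ p ∈ tsupport (uncurry φ), 0 < p.1) {α : ℝ} {U : E4} (hU : U ∈ weakSpace α) :
    ⟪U 1, toL2 fun p => φ p.1 p.2⟫_ℝ = -α * ⟪U 0, toL2 fun p => φ p.1 p.2 + p.1 * dz φ p.1 p.2⟫_ℝ := by
  have cφ : Continuous fun p : ℝ × ℝ => φ p.1 p.2 := hφ.continuous
  have sφ : HasCompactSupport fun p : ℝ × ℝ => φ p.1 p.2 := hφs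
  have m1 : MemLp (fun p : ℝ × ℝ => φ p.1 p.2) 2 stripMeasure := memLp_strip_of_continuous cφ sφ
  have m2 : MemLp (fun p : ℝ × ℝ => φ p.1 p.2 + p.1 * dz φ p.1 p.2) 2 stripMeasure :=
    memLp_strip_of_continuous (by have := (contDiff_dz_of_contDiff (n := 0) hφ).continuous; fun_prop)
      (sφ.add ((hasCompactSupport_dz hφs).mul_left (f := fun p : ℝ × ℝ => p.1)))
  have hcl : IsClosed {U : E4 | ⟪U 1, toL2 fun p => φ p.1 p.2⟫_ℝ = -α * ⟪U 0, toL2 fun p => φ p.1 p.2 + p.1 * dz φ p.1 p.2⟫_ℝ} :=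
    isClosed_eq (continuous_inner_component 1 _) (continuous_const.mul (continuous_inner_component 0 _))
  have hsub : (LinearMap.range (graphL α) : Set E4) ⊆
      {U : E4 | ⟪U 1, toL2 fun p => φ p.1 p.2⟫_ℝ = -α * ⟪U 0, toL2 fun p => φ p.1 p.2 + p.1 * dz φ p.1 p.2⟫_ℝ} := by
    rintro U ⟨χ, rfl⟩
    have h1 : ContDiff ℝ 1 (uncurry (χ : ℝ → ℝ → ℝ)) := χ.2.1 1
    rw [Set.mem_setOf_eq, graphL_apply, graphElt_apply, graphElt_apply, inner_toL2 (memLp_graphFn h1 χ.2.2.1 1) m1,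
      inner_toL2 (memLp_graphFn h1 χ.2.2.1 0) m2]
    exact integral_graphFn_one_mul' hφ hφs hφP h1
  have hU' : U ∈ closure ((LinearMap.range (graphL α) : Set E4)) := by
    rw [← Submodule.topologicalClosure_coe]; exact hU
  exact closure_minimal hsub hcl hU'

/-- **`⟨U₂, φ⟩ = −⟨U₀, ∂_θφ⟩`** for `φ ∈ C¹_c` supported inside `R > 0` (no condition on the angular
boundary: the graphs vanish on `θ = 0, π/2`). [folklore] -/
theorem weakSpace_inner_two' (hφ : ContDiff ℝ 1 (uncurry φ)) (hφs : HasCompactSupport (uncurry φ))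
    {α : ℝ} {U : E4} (hU : U ∈ weakSpace α) :
    ⟪U 2, toL2 fun p => φ p.1 p.2⟫_ℝ = -⟪U 0, toL2 fun p => dθ φ p.1 p.2⟫_ℝ := by
  have cφ : Continuous fun p : ℝ × ℝ => φ p.1 p.2 := hφ.continuous
  have cdθφ : Continuous fun p : ℝ × ℝ => dθ φ p.1 p.2 := (contDiff_dθ_of_contDiff (n := 0) hφ).continuous
  have m1 : MemLp (fun p : ℝ × ℝ => φ p.1 p.2) 2 stripMeasure := memLp_strip_of_continuous cφ hφs
  have m2 : MemLp (fun p : ℝ × ℝ => dθ φ p.1 p.2) 2 stripMeasure := memLp_strip_of_continuous cdθφ (hasCompactSupport_dθ_of hφs)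
  have hcl : IsClosed {U : E4 | ⟪U 2, toL2 fun p => φ p.1 p.2⟫_ℝ = -⟪U 0, toL2 fun p => dθ φ p.1 p.2⟫_ℝ} :=
    isClosed_eq (continuous_inner_component 2 _) (continuous_inner_component 0 _).neg
  have hsub : (LinearMap.range (graphL α) : Set E4) ⊆
      {U : E4 | ⟪U 2, toL2 fun p => φ p.1 p.2⟫_ℝ = -⟪U 0, toL2 fun p => dθ φ p.1 p.2⟫_ℝ} := by
    rintro U ⟨χ, rfl⟩
    have h1 : ContDiff ℝ 1 (uncurry (χ : ℝ → ℝ → ℝ)) := χ.2.1 1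
    rw [Set.mem_setOf_eq, graphL_apply, graphElt_apply, graphElt_apply, inner_toL2 (memLp_graphFn h1 χ.2.2.1 2) m1,
      inner_toL2 (memLp_graphFn h1 χ.2.2.1 0) m2]
    exact integral_graphFn_two_mul' hφ h1 χ.2.2.1 χ.2.2.2.2.1
  have hU' : U ∈ closure ((LinearMap.range (graphL α) : Set E4)) := by
    rw [← Submodule.topologicalClosure_coe]; exact hU
  exact closure_minimal hsub hcl hU'

/-- **`⟨U₃, cos θψ⟩ = ⟨U₀, sin θψ⟩`** for `ψ ∈ C_c` (the `tan` relation against `φ = cos θψ`). [folklore] -/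
theorem weakSpace_inner_three' {ψ : ℝ → ℝ → ℝ} (hψ : Continuous (uncurry ψ)) (hψs : HasCompactSupport (uncurry ψ))
    {α : ℝ} {U : E4} (hU : U ∈ weakSpace α) :
    ⟪U 3, toL2 fun p => Real.cos p.2 * ψ p.1 p.2⟫_ℝ = ⟪U 0, toL2 fun p => Real.sin p.2 * ψ p.1 p.2⟫_ℝ := by
  have cψ : Continuous fun p : ℝ × ℝ => ψ p.1 p.2 := hψ
  have m1 : MemLp (fun p : ℝ × ℝ => Real.cos p.2 * ψ p.1 p.2) 2 stripMeasure :=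
    memLp_strip_of_continuous (by fun_prop) (hψs.mul_left (f := fun p : ℝ × ℝ => Real.cos p.2))
  have m2 : MemLp (fun p : ℝ × ℝ => Real.sin p.2 * ψ p.1 p.2) 2 stripMeasure :=
    memLp_strip_of_continuous (by fun_prop) (hψs.mul_left (f := fun p : ℝ × ℝ => Real.sin p.2))
  have hcl : IsClosed {U : E4 | ⟪U 3, toL2 fun p => Real.cos p.2 * ψ p.1 p.2⟫_ℝ = ⟪U 0, toL2 fun p => Real.sin p.2 * ψ p.1 p.2⟫_ℝ} :=
    isClosed_eq (continuous_inner_component 3 _) (continuous_inner_component 0 _)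
  have hsub : (LinearMap.range (graphL α) : Set E4) ⊆
      {U : E4 | ⟪U 3, toL2 fun p => Real.cos p.2 * ψ p.1 p.2⟫_ℝ = ⟪U 0, toL2 fun p => Real.sin p.2 * ψ p.1 p.2⟫_ℝ} := by
    rintro U ⟨χ, rfl⟩
    have h1 : ContDiff ℝ 1 (uncurry (χ : ℝ → ℝ → ℝ)) := χ.2.1 1
    rw [Set.mem_setOf_eq, graphL_apply, graphElt_apply, graphElt_apply, inner_toL2 (memLp_graphFn h1 χ.2.2.1 3) m1,
      inner_toL2 (memLp_graphFn h1 χ.2.2.1 0) m2]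
    exact integral_graphFn_three_mul' (χ : ℝ → ℝ → ℝ) ψ
  have hU' : U ∈ closure ((LinearMap.range (graphL α) : Set E4)) := by
    rw [← Submodule.topologicalClosure_coe]; exact hU
  exact closure_minimal hsub hcl hU'

end test

/-! ### The very weak equation against `cos²θ·χ` -/

set_option maxHeartbeats 1600000 in
/-- **The energy solution tested against `cos²θ·χ`**: for a weak solution `U` (energy space,
`B(U,·) = ⟨F,·₀⟩`) with `F ⊥ K`, and every smooth `χ` compactly supported inside `R > 0` with
`χ(R,0) = 0`, `∫∫_strip U₀·ᵗL(cos²θ·χ) = ∫∫_strip F·cos²θ·χ`. [cite: Elgindi2021, §7.1 Proposition 7.1 (p. 19 of arXiv:1904.04795)] -/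
theorem integral_energySol_transposeOp_cosSq {α : ℝ} {F : L2Strip}
    (HF : ∀ n : ℝ → ℝ, Continuous n → HasCompactSupport n → ∫ p in strip, (F : ℝ × ℝ → ℝ) p * (n p.1 * kernelK p.2) = 0)
    {U : E4} (hU : U ∈ weakSpace α) (hw : ∀ Ψ ∈ weakSpace α, energyForm α U Ψ = ⟪F, Ψ 0⟫_ℝ)
    {χ : ℝ → ℝ → ℝ} (hχn : ∀ n : ℕ, ContDiff ℝ n (uncurry χ)) (hχs : HasCompactSupport (uncurry χ))
    (hχpos : ∀ p ∈ tsupport (uncurry χ), 0 < p.1) (hχ0 : ∀ R, χ R 0 = 0) :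
    ∫ p in strip, (U 0 : ℝ × ℝ → ℝ) p * transposeOp α (fun R θ => Real.cos θ ^ 2 * χ R θ) p =
      ∫ p in strip, (F : ℝ × ℝ → ℝ) p * (Real.cos p.2 ^ 2 * χ p.1 p.2) := by
  -- the class profile `χ₂ = cos θ·χ` and `Φ = cos θ·χ₂ = cos²θ·χ`
  obtain ⟨χ₂, hχ₂⟩ : ∃ χ₂ : ℝ → ℝ → ℝ, χ₂ = fun R θ => Real.cos θ * χ R θ := ⟨_, rfl⟩
  have hχ₂n : ∀ n : ℕ, ContDiff ℝ n (uncurry χ₂) := fun n => by rw [hχ₂]; exact contDiff_cosProfile (hχn n)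
  have hχ₂s : HasCompactSupport (uncurry χ₂) := by rw [hχ₂]; exact hasCompactSupport_cosProfile hχs
  have hχ₂sub : tsupport (uncurry χ₂) ⊆ tsupport (uncurry χ) := by
    rw [hχ₂]
    exact tsupport_subset_of_eq_zero (X := uncurry χ) (g := uncurry fun R θ => Real.cos θ * χ R θ) fun q hq => by
      show Real.cos q.2 * χ q.1 q.2 = 0; rw [show χ q.1 q.2 = 0 from hq, mul_zero]
  have hχ₂pos : ∀ p ∈ tsupport (uncurry χ₂), 0 < p.1 := fun p hp => hχpos p (hχ₂sub hp)
  have hχ₂0 : ∀ R, χ₂ R 0 = 0 := fun R => by rw [hχ₂]; simp [hχ0 R]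
  have key := weakSolution_test HF hU hw hχ₂n hχ₂s hχ₂pos hχ₂0
  obtain ⟨Φ, hΦ⟩ : ∃ Φ : ℝ → ℝ → ℝ, Φ = fun R θ => Real.cos θ * χ₂ R θ := ⟨_, rfl⟩
  have hΦe : Φ = fun R θ => Real.cos θ ^ 2 * χ R θ := by rw [hΦ, hχ₂]; funext R θ; ring
  have hΦn : ∀ n : ℕ, ContDiff ℝ n (uncurry Φ) := fun n => by rw [hΦ]; exact contDiff_cosProfile (hχ₂n n)
  have hΦ2 : ContDiff ℝ 2 (uncurry Φ) := hΦn 2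
  have hΦ1 : ContDiff ℝ 1 (uncurry Φ) := hΦn 1
  have hΦs : HasCompactSupport (uncurry Φ) := by rw [hΦ]; exact hasCompactSupport_cosProfile hχ₂s
  have hΦsub : tsupport (uncurry Φ) ⊆ tsupport (uncurry χ₂) := by
    rw [hΦ]
    exact tsupport_subset_of_eq_zero (X := uncurry χ₂) (g := uncurry fun R θ => Real.cos θ * χ₂ R θ) fun q hq => by
      show Real.cos q.2 * χ₂ q.1 q.2 = 0; rw [show χ₂ q.1 q.2 = 0 from hq, mul_zero]
  have hΦpos : ∀ p ∈ tsupport (uncurry Φ), 0 < p.1 := fun p hp => hχ₂pos p (hΦsub hp)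
  have hχ₂1 : ContDiff ℝ 1 (uncurry χ₂) := hχ₂n 1
  -- graph components
  have g0 : graphFn α χ₂ 0 = fun p => Φ p.1 p.2 := by funext p; rw [hΦ]; rfl
  have g1 : graphFn α χ₂ 1 = fun p => α * (p.1 * dz Φ p.1 p.2) := by
    funext p; show α * (p.1 * (Real.cos p.2 * dz χ₂ p.1 p.2)) = _; rw [hΦ, dz_cosProfile hχ₂1]
  have g2 : graphFn α χ₂ 2 = fun p => dθ Φ p.1 p.2 := by
    funext p; show -Real.sin p.2 * χ₂ p.1 p.2 + Real.cos p.2 * dθ χ₂ p.1 p.2 = _; rw [hΦ, dθ_cosProfile hχ₂1]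
  rw [energyForm_apply, graphElt_apply, graphElt_apply, graphElt_apply, g0, g1, g2] at key
  -- `∂_θΦ = cos θ·ψ` with `ψ = −2 sin θχ + cos θ∂_θχ`
  obtain ⟨ψ, hψ⟩ : ∃ ψ : ℝ → ℝ → ℝ, ψ = fun R θ => -2 * Real.sin θ * χ R θ + Real.cos θ * dθ χ R θ := ⟨_, rfl⟩
  have hχ1 : ContDiff ℝ 1 (uncurry χ) := hχn 1
  have hχ2 : ContDiff ℝ 2 (uncurry χ) := hχn 2
  have hψc : Continuous (uncurry ψ) := by
    rw [hψ]
    have e : uncurry (fun R θ => -2 * Real.sin θ * χ R θ + Real.cos θ * dθ χ R θ) =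
        fun p : ℝ × ℝ => -2 * Real.sin p.2 * uncurry χ p + Real.cos p.2 * uncurry (dθ χ) p := by funext p; rfl
    rw [e]
    have := (contDiff_dθ_of_contDiff (n := 0) hχ1).continuous; have := hχ1.continuous; fun_prop
  have hψs : HasCompactSupport (uncurry ψ) := by
    rw [hψ]
    have e : uncurry (fun R θ => -2 * Real.sin θ * χ R θ + Real.cos θ * dθ χ R θ) =
        fun p : ℝ × ℝ => (-2 * Real.sin p.2) * uncurry χ p + Real.cos p.2 * uncurry (dθ χ) p := by funext p; rfl
    rw [e]; exact (hχs.mul_left).add ((hasCompactSupport_dθ_of hχs).mul_left)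
  have hdθΦ : ∀ p : ℝ × ℝ, dθ Φ p.1 p.2 = Real.cos p.2 * ψ p.1 p.2 := by
    intro p
    rw [hΦe, hψ]
    have hd : HasDerivAt (fun θ => Real.cos θ ^ 2 * χ p.1 θ)
        (2 * Real.cos p.2 * -Real.sin p.2 * χ p.1 p.2 + Real.cos p.2 ^ 2 * dθ χ p.1 p.2) p.2 := by
      have hc2 : HasDerivAt (fun θ => Real.cos θ ^ 2) (2 * Real.cos p.2 * -Real.sin p.2) p.2 := by
        have := (Real.hasDerivAt_cos p.2).pow 2; refine this.congr_deriv ?_; simp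
      have hχd : HasDerivAt (fun θ => χ p.1 θ) (dθ χ p.1 p.2) p.2 :=
        (((hχ1.comp (contDiff_const.prodMk contDiff_id)).differentiable (by simp)) p.2).hasDerivAt
      exact hc2.mul hχd
    show deriv (fun θ => Real.cos θ ^ 2 * χ p.1 θ) p.2 = _
    rw [hd.deriv]; ring
  -- the auxiliary radial test function
  obtain ⟨φ₁, hφ₁⟩ : ∃ φ₁ : ℝ → ℝ → ℝ, φ₁ = fun R θ => α * (R * dz Φ R θ) := ⟨_, rfl⟩
  have hφ₁c : ContDiff ℝ 1 (uncurry φ₁) := by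
    rw [hφ₁]
    have e : uncurry (fun R θ => α * (R * dz Φ R θ)) = fun p : ℝ × ℝ => α * (p.1 * uncurry (dz Φ) p) := by funext p; rfl
    rw [e]; exact contDiff_const.mul (contDiff_fst.mul (contDiff_dz_of_contDiff (n := 1) hΦ2))
  have eφ₁ : uncurry (fun R θ => α * (R * dz Φ R θ)) = fun p : ℝ × ℝ => (α * p.1) * uncurry (dz Φ) p := by
    funext p; simp [uncurry]; ring
  have hφ₁s : HasCompactSupport (uncurry φ₁) := by rw [hφ₁, eφ₁]; exact (hasCompactSupport_dz hΦs).mul_left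
  have hφ₁P : ∀ p ∈ tsupport (uncurry φ₁), 0 < p.1 := by
    rw [hφ₁, eφ₁]; exact fun p hp => hΦpos p (tsupport_dz_subset (tsupport_mul_subset_right hp))
  have hφ₂c : ContDiff ℝ 1 (uncurry (dθ Φ)) := contDiff_dθ_of_contDiff (n := 1) hΦ2
  have hφ₂s : HasCompactSupport (uncurry (dθ Φ)) := hasCompactSupport_dθ_of hΦs
  -- the graph relations up to the boundary
  have r1 := weakSpace_inner_one' hφ₁c hφ₁s hφ₁P (α := α) hU
  have r1' := weakSpace_inner_one' hΦ1 hΦs hΦpos (α := α) hU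
  have r2 := weakSpace_inner_two' hφ₂c hφ₂s (α := α) hU
  have r3 := weakSpace_inner_three' hψc hψs (α := α) hU
  have eg2 : (toL2 fun p : ℝ × ℝ => dθ Φ p.1 p.2) = toL2 fun p : ℝ × ℝ => Real.cos p.2 * ψ p.1 p.2 := by
    congr 1; funext p; exact hdθΦ p
  simp only [hφ₁, dz_radialWeight hΦ2] at r1
  rw [eg2] at key
  rw [r1, r1', r3] at key
  rw [← eg2, r2] at key
  -- everything as strip integrals against `U₀`
  have cΦ : Continuous fun p : ℝ × ℝ => Φ p.1 p.2 := hΦ1.continuous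
  have cdz : Continuous fun p : ℝ × ℝ => dz Φ p.1 p.2 := (contDiff_dz_of_contDiff (n := 0) hΦ1).continuous
  have cdz2 : Continuous fun p : ℝ × ℝ => dz (dz Φ) p.1 p.2 :=
    (contDiff_dz_of_contDiff (n := 0) (contDiff_dz_of_contDiff (n := 1) hΦ2)).continuous
  have cdθ2 : Continuous fun p : ℝ × ℝ => dθ (dθ Φ) p.1 p.2 := (contDiff_dθ_of_contDiff (n := 0) hφ₂c).continuous
  have sdz : HasCompactSupport fun p : ℝ × ℝ => dz Φ p.1 p.2 := hasCompactSupport_dz hΦs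
  have sdz2 : HasCompactSupport fun p : ℝ × ℝ => dz (dz Φ) p.1 p.2 := hasCompactSupport_dz (hasCompactSupport_dz hΦs)
  have sdθ2 : HasCompactSupport fun p : ℝ × ℝ => dθ (dθ Φ) p.1 p.2 := hasCompactSupport_dθ_of hφ₂s
  have sΦ : HasCompactSupport fun p : ℝ × ℝ => Φ p.1 p.2 := hΦs
  have cψ : Continuous fun p : ℝ × ℝ => ψ p.1 p.2 := hψc
  set hA : ℝ × ℝ → ℝ := fun p => α * (p.1 * dz Φ p.1 p.2) + p.1 * (α * (dz Φ p.1 p.2 + p.1 * dz (dz Φ) p.1 p.2)) with hhA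
  set hB : ℝ × ℝ → ℝ := fun p => Φ p.1 p.2 + p.1 * dz Φ p.1 p.2 with hhB
  set hC : ℝ × ℝ → ℝ := fun p => dθ (dθ Φ) p.1 p.2 with hhC
  set hD : ℝ × ℝ → ℝ := fun p => Real.sin p.2 * ψ p.1 p.2 with hhD
  set hE : ℝ × ℝ → ℝ := fun p => Φ p.1 p.2 with hhE
  have mA : MemLp hA 2 stripMeasure := memLp_strip_of_continuous (by simp only [hhA]; fun_prop)
    ((sdz.mul_left (f := fun p : ℝ × ℝ => p.1)).mul_left.add ((sdz.add (sdz2.mul_left (f := fun p : ℝ × ℝ => p.1))).mul_left.mul_left))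
  have mB : MemLp hB 2 stripMeasure := memLp_strip_of_continuous (by simp only [hhB]; fun_prop) (sΦ.add (sdz.mul_left (f := fun p : ℝ × ℝ => p.1)))
  have mC : MemLp hC 2 stripMeasure := memLp_strip_of_continuous cdθ2 sdθ2
  have mD : MemLp hD 2 stripMeasure := memLp_strip_of_continuous (by simp only [hhD]; fun_prop) (hψs.mul_left (f := fun p : ℝ × ℝ => Real.sin p.2))
  have mE : MemLp hE 2 stripMeasure := memLp_strip_of_continuous cΦ sΦ
  rw [inner_toL2_eq_integral _ mA, inner_toL2_eq_integral _ mB, inner_toL2_eq_integral _ mC, inner_toL2_eq_integral _ mD,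
    inner_toL2_eq_integral _ mE, inner_toL2_eq_integral _ mE] at key
  have eRHS : ∫ p in strip, (F : ℝ × ℝ → ℝ) p * (Real.cos p.2 ^ 2 * χ p.1 p.2) = ∫ p in strip, (F : ℝ × ℝ → ℝ) p * hE p := by
    refine integral_congr_ae (ae_of_all _ fun p => ?_); simp only [hhE, hΦe]
  rw [eRHS, ← key]
  have iA := integrable_coe_mul (U 0) mA
  have iB := integrable_coe_mul (U 0) mB
  have iC := integrable_coe_mul (U 0) mC
  have iD := integrable_coe_mul (U 0) mD
  have iE := integrable_coe_mul (U 0) mE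
  -- on the strip `tan θ·∂_θΦ = sin θ·ψ`
  have eT : ∀ p ∈ strip, (U 0 : ℝ × ℝ → ℝ) p * transposeOp α (fun R θ => Real.cos θ ^ 2 * χ R θ) p =
      (-α) * ((U 0 : ℝ × ℝ → ℝ) p * hA p) + (-α * (α - 5)) * ((U 0 : ℝ × ℝ → ℝ) p * hB p) +
        (-1) * ((U 0 : ℝ × ℝ → ℝ) p * hC p) + (-1) * ((U 0 : ℝ × ℝ → ℝ) p * hD p) + (-6) * ((U 0 : ℝ × ℝ → ℝ) p * hE p) := by
    intro p hp
    have hcos : Real.cos p.2 ≠ 0 := (Real.cos_pos_of_mem_Ioo ⟨by linarith [hp.2.1, Real.pi_pos], hp.2.2⟩).ne'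
    have htan : Real.tan p.2 * dθ Φ p.1 p.2 = Real.sin p.2 * ψ p.1 p.2 := by
      rw [hdθΦ p, Real.tan_eq_sin_div_cos]; field_simp
    rw [← hΦe, transposeOp_apply, htan]
    simp only [hhA, hhB, hhC, hhD, hhE]
    ring
  rw [setIntegral_congr_fun measurableSet_strip eT, integral_add, integral_add, integral_add, integral_add,
    MeasureTheory.integral_const_mul, MeasureTheory.integral_const_mul,
    MeasureTheory.integral_const_mul, MeasureTheory.integral_const_mul, MeasureTheory.integral_const_mul]
  · ring
  all_goals first
    | exact iA.const_mul _
    | exact (iA.const_mul _).add (iB.const_mul _)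
    | exact ((iA.const_mul _).add (iB.const_mul _)).add (iC.const_mul _)
    | exact (((iA.const_mul _).add (iB.const_mul _)).add (iC.const_mul _)).add (iD.const_mul _)
    | exact iB.const_mul _
    | exact iC.const_mul _
    | exact iD.const_mul _
    | exact iE.const_mul _

end Elgindi

end Literature.Analysis.FluidPDE
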